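import Summits.BirchSwinnertonDyer.BirchSwinnertonDyer.Theorems.AdditiveKolyvaginRoadLevelSystems
import Literature.NumberTheory.GaloisRepresentations.LocalGlobalCohomology
import HarnessLib

/-!
# Route `AdditiveKolyvaginRoad`, crux `KolyvaginPrimitiveAdditive` (item stmt-BirchSwinnertonDyer-20132):
# the LOCAL–GLOBAL PACKAGE of W. Zhang's induction at a GENERAL prime `p`, as pinned-shape data
# (cell `pub/bsd-wall`, lead prover `bsd-wall-akr-p1` g3; definitions, `--supports stmt-BirchSwinnertonDyer-20132`;
# the `p`-generic companion of the binders of zhang3-p1's `Method2.triangulation_of_localGlobal` ∕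
# `Method2.inductionOfLevelSystems_of_localGlobal` at `p = 3`)

WHY THIS FILE. The registered skeleton of crux 20132 (line `birth`) carries, above the bottom, W. Zhang's induction on
the `p`-Selmer rank GIVEN (A1) (stub A1 `stub_rankLoweringAdditive`, LANDED p521749). Its honest re-cut (the
19574 method2 v3 precedent, here at general `p`) is: S2-KS — the LEVEL KOLYVAGIN SYSTEMS exist
(`Nonempty (LevelKolyvaginSystemP …)`, `Theorems/AdditiveKolyvaginRoadLevelSystems.lean`, OPEN at `p² ∣ N`); S2-LOC —
the LOCAL–GLOBAL PACKAGE at the places of `K` (this file: `Nonempty (KolyvaginLocalPackageP …)`, E-side, in print);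
S2-ENGINE — Zhang's §9 induction from the two packages and (A1) (provable: the tree's p-uniform engine
`ZhangTriangulation.exists_ne_zero_of_zhangInduction_on_of_kolyvaginSystem_finite_oddStart`). This file TYPES the
second package so that S2-LOC and S2-ENGINE have a name to quantify over. Vocabulary only; nothing is asserted.

WHAT. `KolyvaginLocalPackageP W K p ι c` bundles, over the GENUINE localisations
`loc_v = galoisCohomology.localization (E[p]) v 1 : H¹(K, E[p]) →+ H¹(K_v, E[p])` at the places `v : Place K`:
* `b v` — a `ZMod p`-bilinear form on `H¹(K_v, E[p])` at every place (in the model: `inv_v ∘ (· ∪_e ·)` for a Weil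
  pairing `e`, the local Tate pairing) [Milne ADT I Cor. 2.3];
* `reciprocity` — (REC) `∑_{v ∈ T} b_v(loc_v x, loc_v y) = 0` whenever the terms off `T` vanish [Milne ADT I Thm. 4.10,
  Poitou–Tate for the totally complex `K`];
* `isoKummer` — E's local Kummer condition `kummerLocalConditionAt` is isotropic at every place [Poonen–Rains
  Prop. 4.10 ∕ local Tate duality];
* `isoToric` — the TORIC condition `toricLocalKer` is isotropic at the place of every Bertolini–Darmon admissible prime
  `q` (`AdmQ`: `Frob_q² ≠ 1` on `E[p]`, so the augmentation line has order `≤ p`) [W. Zhang Prop. 5.4; BD05 §2.3] —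
  asked ONLY above admissible primes (at a place whose Frobenius acts trivially on `E[p]` a blanket toric isotropy
  would be false currency, cf. zhang3-p1 g9's level-wise repair at `p = 3`);
* `isoTransverse`, `perf`, `line` — at the place of every Kolyvagin prime `ℓ` (`Zhang2014.IsKolyvaginPrime … p ℓ`):
  the TRANSVERSE condition `transverseLocalKerP` is isotropic; a Kummer eigenclass non-zero at `ℓ` pairs
  non-trivially with a transverse eigenclass of the same sign non-zero at `ℓ` ((Perf): `H¹(K_λ, E[p]) = H¹_f ⊕ H¹_tr`,
  eigen-lines `f^s × tr^s → 𝔽_p` perfect); the Kummer eigen-line ((Line)) [W. Zhang §8.1, Lemma 8.1; Gross 1991 §4;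
  McCallum 1991 §4];
* `supply` — (Supply) W. Zhang's Lemma 8.2 for the level-`n` structure at every NON-EMPTY admissible level `n`: for a
  Kolyvagin prime `ℓ ∉ T` and a sign `s`, a non-zero `s`-eigenclass, Kummer at the infinite places and at the finite
  places away from `ℓ`, `T` and `n`, TORIC above `n`, TRANSVERSE above `T`, free at `ℓ` [W. Zhang Lemma 8.2].
The `ZMod p`-structures on `H¹(K, E[p])` and on the `H¹(K_v, E[p])` are instance binders (all such structures agree).
The places are quantified as `∀ v, (ℓ : 𝓞 K) ∈ v` (the place above an inert prime is unique), so the structure carries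
no choice of places. (Body = the binders `b`, `hrec`, `hisoKum`, `hisoOrd`, `hisoTr`, `hperf`, `hline`, `hSupply` of
zhang3-p1's `Method2.triangulation_of_localGlobal` with `3 ↦ p`, ordinary ↦ toric, unipotent-admissible ↦
BD-admissible, `GoodLevel` dropped, `sgn ↦ sgnP`.)

HONEST FRAMING: one structure (definition with body); 0 named facts, 0 `sorry`, no instance, no notation; nothing is
asserted to exist; closes nothing. `Nonempty (KolyvaginLocalPackageP …)` at a ♯ additive frame is the proposed stub
S2-LOC of the skeleton; its first four fields are dischargeable from tree theorems today (Poitou–Tate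
`poitouTate_sum_localTatePairing_eq_zero_of_isTotallyComplex`, Poonen–Rains `kummerClass_cupProduct_kummerClass_eq_zero`,
akr-p1 g2's `weilCupProduct_res_eq_zero_of_valued` ∕ `natCard_augmentation_le_of_admQ`), the Kolyvagin-prime trio is the
`p`-generic port of zhang3-p1's `…Method2Kolyvagin{TransverseIsotropy,Perf,Line}` files, and `supply` is Zhang's
Lemma 8.2 (E-side, in print for every `p`).

References: [cite: WZhang2014, §8.1, Lemma 8.1, Lemma 8.2, Lemma 8.4, Prop. 5.4, §9] [cite: MilneADT2006, Ch. I,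
Cor. 2.3, Thm. 4.10] [cite: PoonenRains2012, Prop. 4.10] [cite: GrossLMS1991, §4 (4.4)–(4.5)] [cite: McCallumLMS1991,
§4 (H¹_f ⊕ H¹_s)] [cite: BertoliniDarmon2005, §2.2–§2.3].
-/

-- single-conjunct summit: `Summit.BirchSwinnertonDyer.BirchSwinnertonDyer.…` repeats the name by design
set_option linter.dupNamespace false

noncomputable section

open scoped Classical

namespace Summit.BirchSwinnertonDyer.BirchSwinnertonDyer.Theorems.AdditiveKoly

open WeierstrassCurve NumberField IsDedekindDomain
  Literature.NumberTheory.EllipticCurves Literature.NumberTheory.EllipticCurves.ModularForms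
  Literature.NumberTheory.GaloisRepresentations Module

variable (W : WeierstrassCurve ℚ) (K : Type) [Field K] [NumberField K] (p : ℕ)
  [W.IsElliptic] [W.IsGloballyMinimal] [NeZero (W.conductorNorm ℤ)] [Fact p.Prime]
  (ι : K →+* ℂ) (c : K ≃ₐ[ℚ] K)
  [Module (ZMod p) (Vp W K p)]
  [∀ v : Place K, Module (ZMod p)
    (galoisCohomology (((W.baseChange K).torsionGaloisModule ((p ^ 1 : ℕ) : ℤ)).toLocal v) 1)]

/-- **The LOCAL–GLOBAL PACKAGE of W. Zhang's induction at a general prime `p`, as pinned-shape data** (the body of the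
proposed stub S2-LOC of the S2 re-line of crux 20132). Over the genuine localisations
`loc_v = galoisCohomology.localization (E[p]) v 1`: a `ZMod p`-bilinear local form `b v` on `H¹(K_v, E[p])` at every
place with (REC) `reciprocity`; isotropy of E's Kummer condition everywhere (`isoKummer`), of the TORIC condition above every
Bertolini–Darmon admissible prime (`isoToric`), of the TRANSVERSE condition above every Kolyvagin prime
(`isoTransverse`); (Perf) `perf` and (Line) `line` at Kolyvagin primes for the eigenspaces of complex conjugation `c`;
(Supply) `supply` = Zhang's Lemma 8.2 for the level structure at every non-empty admissible level. (Body = the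
level-independent binders of zhang3-p1's `Method2.triangulation_of_localGlobal` with `3 ↦ p`, ordinary ↦ toric,
unipotent-admissible ↦ BD-admissible, `GoodLevel` dropped.) Existence is NOT claimed. [cite: WZhang2014, §8.1,
Lemma 8.1, Lemma 8.2, Prop. 5.4] [cite: MilneADT2006, Ch. I, Cor. 2.3, Thm. 4.10] [cite: PoonenRains2012, Prop. 4.10]
[cite: BertoliniDarmon2005, §2.2–§2.3] -/
structure KolyvaginLocalPackageP where
  /-- the local bilinear forms `b_v : H¹(K_v, E[p]) × H¹(K_v, E[p]) → 𝔽_p` (local Tate pairing through a Weil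
  pairing) -/
  b : (v : Place K) →
    galoisCohomology (((W.baseChange K).torsionGaloisModule ((p ^ 1 : ℕ) : ℤ)).toLocal v) 1 →ₗ[ZMod p]
    galoisCohomology (((W.baseChange K).torsionGaloisModule ((p ^ 1 : ℕ) : ℤ)).toLocal v) 1 →ₗ[ZMod p] ZMod p
  /-- (REC): the sum of the local terms of two global classes over any finite set of places containing the support
  vanishes (Poitou–Tate for the totally complex `K`). -/
  reciprocity : ∀ (x y : Vp W K p) (T : Finset (Place K)),
    (∀ v, v ∉ T →
      b v (galoisCohomology.localization ((W.baseChange K).torsionGaloisModule ((p ^ 1 : ℕ) : ℤ)) v 1 x)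
        (galoisCohomology.localization ((W.baseChange K).torsionGaloisModule ((p ^ 1 : ℕ) : ℤ)) v 1 y) = 0) →
    ∑ v ∈ T,
      b v (galoisCohomology.localization ((W.baseChange K).torsionGaloisModule ((p ^ 1 : ℕ) : ℤ)) v 1 x)
        (galoisCohomology.localization ((W.baseChange K).torsionGaloisModule ((p ^ 1 : ℕ) : ℤ)) v 1 y) = 0
  /-- E's local Kummer condition is isotropic at every place. -/
  isoKummer : ∀ (v : Place K),
    ∀ x ∈ (W.baseChange K).kummerLocalConditionAt ((p ^ 1 : ℕ) : ℤ) (Place.Completion v),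
    ∀ y ∈ (W.baseChange K).kummerLocalConditionAt ((p ^ 1 : ℕ) : ℤ) (Place.Completion v), b v x y = 0
  /-- the TORIC condition is isotropic above every Bertolini–Darmon admissible prime. -/
  isoToric : ∀ (q : AdmQ W K p) (v : HeightOneSpectrum (𝓞 K)), ((q : ℕ) : 𝓞 K) ∈ v.asIdeal →
    ∀ (x y : Vp W K p),
    x ∈ toricLocalKer (W.baseChange K) (v.adicCompletion K) ((p ^ 1 : ℕ) : ℤ) →
    y ∈ toricLocalKer (W.baseChange K) (v.adicCompletion K) ((p ^ 1 : ℕ) : ℤ) →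
    b (Sum.inr v)
      (galoisCohomology.localization ((W.baseChange K).torsionGaloisModule ((p ^ 1 : ℕ) : ℤ)) (Sum.inr v) 1 x)
      (galoisCohomology.localization ((W.baseChange K).torsionGaloisModule ((p ^ 1 : ℕ) : ℤ)) (Sum.inr v) 1 y) = 0
  /-- the TRANSVERSE condition is isotropic above every Kolyvagin prime. -/
  isoTransverse : ∀ (ℓ : ℕ), Zhang2014.IsKolyvaginPrime (W.conductorNorm ℤ) W K p ℓ →
    ∀ (v : HeightOneSpectrum (𝓞 K)), ((ℓ : ℕ) : 𝓞 K) ∈ v.asIdeal → ∀ (x y : Vp W K p),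
    x ∈ transverseLocalKerP W K p ι ℓ v → y ∈ transverseLocalKerP W K p ι ℓ v →
    b (Sum.inr v)
      (galoisCohomology.localization ((W.baseChange K).torsionGaloisModule ((p ^ 1 : ℕ) : ℤ)) (Sum.inr v) 1 x)
      (galoisCohomology.localization ((W.baseChange K).torsionGaloisModule ((p ^ 1 : ℕ) : ℤ)) (Sum.inr v) 1 y) = 0
  /-- (Perf) above every Kolyvagin prime: a Kummer `s`-eigenclass non-zero at `λ` and a transverse `s`-eigenclass
  non-zero at `λ` pair non-trivially. -/
  perf : ∀ (ℓ : ℕ), Zhang2014.IsKolyvaginPrime (W.conductorNorm ℤ) W K p ℓ →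
    ∀ (v : HeightOneSpectrum (𝓞 K)), ((ℓ : ℕ) : 𝓞 K) ∈ v.asIdeal → ∀ (s : Bool) (x y : Vp W K p),
    conjAct W c ((p ^ 1 : ℕ) : ℤ) x = sgnP s • x → conjAct W c ((p ^ 1 : ℕ) : ℤ) y = sgnP s • y →
    x ∈ selmerLocalKer (W.baseChange K) (v.adicCompletion K) ((p ^ 1 : ℕ) : ℤ) →
    x ∉ (W.baseChange K).torsionLocalKer (v.adicCompletion K) ((p ^ 1 : ℕ) : ℤ) →
    y ∈ transverseLocalKerP W K p ι ℓ v →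
    y ∉ (W.baseChange K).torsionLocalKer (v.adicCompletion K) ((p ^ 1 : ℕ) : ℤ) →
    b (Sum.inr v)
      (galoisCohomology.localization ((W.baseChange K).torsionGaloisModule ((p ^ 1 : ℕ) : ℤ)) (Sum.inr v) 1 x)
      (galoisCohomology.localization ((W.baseChange K).torsionGaloisModule ((p ^ 1 : ℕ) : ℤ)) (Sum.inr v) 1 y) ≠ 0
  /-- (Line) above every Kolyvagin prime: the localisations of the Kummer `s`-eigenclasses lie on one line. -/
  line : ∀ (ℓ : ℕ), Zhang2014.IsKolyvaginPrime (W.conductorNorm ℤ) W K p ℓ →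
    ∀ (v : HeightOneSpectrum (𝓞 K)), ((ℓ : ℕ) : 𝓞 K) ∈ v.asIdeal → ∀ (s : Bool),
    ∃ e : galoisCohomology (((W.baseChange K).torsionGaloisModule ((p ^ 1 : ℕ) : ℤ)).toLocal (Sum.inr v)) 1,
    ∀ x : Vp W K p, conjAct W c ((p ^ 1 : ℕ) : ℤ) x = sgnP s • x →
      x ∈ selmerLocalKer (W.baseChange K) (v.adicCompletion K) ((p ^ 1 : ℕ) : ℤ) →
      ∃ a : ZMod p,
        galoisCohomology.localization ((W.baseChange K).torsionGaloisModule ((p ^ 1 : ℕ) : ℤ)) (Sum.inr v) 1 x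
          = a • e
  /-- (Supply) = W. Zhang's Lemma 8.2 for the level-`n` structure at every non-empty admissible level `n`: for a
  Kolyvagin prime `ℓ` outside a finite set `T` of Kolyvagin primes and a sign `s`, a NON-ZERO `s`-eigenclass which is
  Kummer at the infinite places, Kummer at the finite places away from `ℓ`, `T` and `n`, TORIC above `n`, TRANSVERSE
  above `T` (and free at `ℓ`). -/
  supply : ∀ (n : Finset (AdmQ W K p)), n.Nonempty →
    ∀ (ℓ : {ℓ // Zhang2014.IsKolyvaginPrime (W.conductorNorm ℤ) W K p ℓ})
      (T : Finset {ℓ // Zhang2014.IsKolyvaginPrime (W.conductorNorm ℤ) W K p ℓ}), ℓ ∉ T →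
    ∀ s : Bool, ∃ x : Vp W K p, conjAct W c ((p ^ 1 : ℕ) : ℤ) x = sgnP s • x ∧ x ≠ 0 ∧
      (∀ w : InfinitePlace K, x ∈ selmerLocalKer (W.baseChange K) w.Completion ((p ^ 1 : ℕ) : ℤ)) ∧
      (∀ v : HeightOneSpectrum (𝓞 K), ((ℓ : ℕ) : 𝓞 K) ∉ v.asIdeal →
        (∀ ℓ' ∈ T, ((ℓ' : ℕ) : 𝓞 K) ∉ v.asIdeal) →
        ((∀ q ∈ n, ((q : ℕ) : 𝓞 K) ∉ v.asIdeal) →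
          x ∈ selmerLocalKer (W.baseChange K) (v.adicCompletion K) ((p ^ 1 : ℕ) : ℤ)) ∧
        (∀ q ∈ n, ((q : ℕ) : 𝓞 K) ∈ v.asIdeal →
          x ∈ toricLocalKer (W.baseChange K) (v.adicCompletion K) ((p ^ 1 : ℕ) : ℤ))) ∧
      (∀ ℓ' ∈ T, ∀ v : HeightOneSpectrum (𝓞 K), ((ℓ' : ℕ) : 𝓞 K) ∈ v.asIdeal →
        x ∈ transverseLocalKerP W K p ι ℓ' v)

end Summit.BirchSwinnertonDyer.BirchSwinnertonDyer.Theorems.AdditiveKoly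

end
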